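import Summits.AtomisticToContinuum.HydrodynamicLimit.Theorems.EnskogAdjointDualityCollisionResidualVanishesResidualAssembly
import HarnessLib

/-!
# EnskogAdjointDuality / CollisionResidualVanishes — the pathwise duality estimates with an
# energy-relative velocity cutoff

Support lemmas for the crux `Summit.AtomisticToContinuum.HydrodynamicLimit.Theses.EnskogAdjointDuality.CollisionResidualVanishes`
(K1, stmt-AtomisticToContinuum-14658, line `birth`, lead c6). The sibling crux
`AdjointEnskogTestFamilyR` (K2R) was found false AS TYPED by its line lead (2026-08-17,
`Cruxes/AdjointEnskogTestFamilyR/HyperVelocityObstruction.md`): no admissible test family can have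
defect `|Dφ^N + L^Nφ^N| ≤ η_N(1+|v|²)` for ALL `v ∈ ℝ³` (an isotropic log cascade at hyper-velocities
`|v| ≍ λ_N e^{O(λ_N)}` forbids it); the proposed repair asks the defect bound only below a velocity
cutoff. The two pathwise estimates of the duality glue — `pathwise_duality_bound` (forward: the
tested hydrodynamic quantity at time `t` is controlled by the collision residual) and
`pathwise_residual_bound` (converse) — evaluate the defect ONLY at particle velocities of the orbit,
and along a good orbit every particle velocity satisfies `|vᵢ(s)|² ≤ Σⱼ |vⱼ(0)|²` (conserved kinetic
energy, `norm_sq_vel_flow_le`). This file records the corresponding CUTOFF versions: the defect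
bound is asked only for `‖v‖² ≤ Σⱼ ‖vⱼ(0)‖²`, the conclusions are unchanged. They are the pathwise
input of every velocity-cutoff repair of the route's assembly (`closes`) and of the converse
duality theorem (`collisionResidual_tendsto_zero_of_tendstoHydroFieldsAt`).

* `orbit_integral_cutKernel_eq` — replacing the kernel `L` above the orbit's energy shell does not
  change `⟨μ_{z(s)}, L_s⟩`; `exists_cutKernel` — a kernel equal to `L` below the shell with defect
  bound everywhere;
* `pathwise_duality_bound_cut`, `pathwise_residual_bound_cut` — the two estimates under the
  energy-relative cutoff (proved by running the landed estimates with the kernel modified above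
  the energy shell so that its defect vanishes there); `pathwise_residual_bound_poly` — the crude
  version under a global polynomial defect bound (no smallness), for the large-energy event.

References: M. Pulvirenti, S. Simonella, arXiv:1504.03215, §2 [PulvirentiSimonella2016];
H. Spohn (1991), Part I §3.2 [Spohn1991].
-/

noncomputable section

open MeasureTheory Set Filter Topology Function
open scoped ENNReal BigOperators InnerProductSpace

namespace Summit.AtomisticToContinuum.HydrodynamicLimit.Theorems

open Literature.Analysis.FluidPDE Literature.MathematicalPhysics.KineticTheory

variable {N : ℕ} {ε : ℝ}

/-! ## Modifying the kernel above the energy shell of the orbit -/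

/-- **Above the energy shell the kernel is invisible to the orbit.** If two kernels `L, L'` agree
at every `(s, x, v)` with `‖v‖² ≤ Σⱼ ‖vⱼ(0)‖²`, then along a good orbit `⟨μ_{z(s)}, L_s⟩ =
⟨μ_{z(s)}, L'_s⟩` for every `s` (each particle velocity lies below the conserved total kinetic
energy, `norm_sq_vel_flow_le`). [folklore] -/
theorem orbit_integral_cutKernel_eq (Φ : HardSphereFlow (Torus.geometry (Fin 3)) ε N)
    {z : Config N (Fin 3) T3} (hz : z ∈ Φ.good) (L L' : ℝ → T3 → V3 → ℝ)
    (hLL' : ∀ s x v, ‖v‖ ^ 2 ≤ ∑ j, ‖(z j).2‖ ^ 2 → L' s x v = L s x v) (s : ℝ) :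
    (∫ y, L' s y.1 y.2 ∂(empiricalMeasure (Φ.flow s z))) =
      ∫ y, L s y.1 y.2 ∂(empiricalMeasure (Φ.flow s z)) := by
  rw [integral_empiricalMeasure (Φ.flow s z) (fun y => L' s y.1 y.2),
    integral_empiricalMeasure (Φ.flow s z) (fun y => L s y.1 y.2)]
  congr 1
  refine Finset.sum_congr rfl fun i _ => ?_
  exact hLL' s _ _ (norm_sq_vel_flow_le Φ hz s i)

/-- **A kernel cut at the energy shell.** Given the defect bound below the shell `‖v‖² ≤ S`, there
is a kernel agreeing with `L` below the shell whose defect obeys the bound EVERYWHERE (take `L`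
below the shell and minus the transport term above it, so that the defect vanishes there).
[folklore] -/
theorem exists_cutKernel (t S : ℝ) (φ L : ℝ → T3 → V3 → ℝ) {η : ℝ} (hη : 0 ≤ η)
    (hDL : ∀ s ∈ Icc 0 t, ∀ x v, ‖v‖ ^ 2 ≤ S →
      |derivWithin (fun r => φ r ((Torus.geometry (Fin 3)).translate x ((r - s) • v)) v) (Icc 0 t) s +
        L s x v| ≤ η * (1 + ‖v‖ ^ 2)) :
    ∃ L' : ℝ → T3 → V3 → ℝ, (∀ s x v, ‖v‖ ^ 2 ≤ S → L' s x v = L s x v) ∧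
      ∀ s ∈ Icc 0 t, ∀ x v,
        |derivWithin (fun r => φ r ((Torus.geometry (Fin 3)).translate x ((r - s) • v)) v) (Icc 0 t) s +
          L' s x v| ≤ η * (1 + ‖v‖ ^ 2) := by
  refine ⟨fun s x v => if ‖v‖ ^ 2 ≤ S then L s x v else
    -derivWithin (fun r => φ r ((Torus.geometry (Fin 3)).translate x ((r - s) • v)) v) (Icc 0 t) s,
    fun s x v hv => by simp only [if_pos hv], fun s hs x v => ?_⟩
  by_cases hv : ‖v‖ ^ 2 ≤ S
  · simp only [if_pos hv]
    exact hDL s hs x v hv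
  · simp only [if_neg hv, add_neg_cancel, abs_zero]
    positivity

/-! ## The two pathwise estimates under the energy-relative cutoff -/

/-- **The pathwise duality estimate, velocity cutoff at the energy shell.** As
`pathwise_duality_bound`, but the defect bound `|Dφ + Lφ| ≤ η(1+|v|²)` on `[0, t]` is asked only
for velocities below the conserved total kinetic energy of the datum, `‖v‖² ≤ Σⱼ ‖vⱼ(0)‖²` — the only
velocities at which the orbit ever evaluates it. Conclusion unchanged:
`|A_t − B_t| ≤ |A_0 − B_0| + η t (1 + e(z)) + |I₃ + ½I₂| + |R| + |Res|`.
[cite: PulvirentiSimonella2016, §2] -/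
theorem pathwise_duality_bound_cut (Φ : HardSphereFlow (Torus.geometry (Fin 3)) ε (N + 1))
    {z : Config (N + 1) (Fin 3) T3} (hz : z ∈ Φ.good) {t : ℝ} (ht : 0 < t)
    (φ L : ℝ → T3 → V3 → ℝ) {η : ℝ}
    (hφ : ∀ x v, ContDiffOn ℝ 1
      (fun r => φ r ((Torus.geometry (Fin 3)).translate x (r • v)) v) (Icc 0 t))
    (hDL : ∀ s ∈ Icc 0 t, ∀ x v, ‖v‖ ^ 2 ≤ ∑ j, ‖(z j).2‖ ^ 2 →
      |derivWithin (fun r => φ r ((Torus.geometry (Fin 3)).translate x ((r - s) • v)) v) (Icc 0 t) s +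
        L s x v| ≤ η * (1 + ‖v‖ ^ 2))
    (hLint : IntegrableOn (fun s => ∫ y, L s y.1 y.2 ∂(empiricalMeasure (Φ.flow s z))) (Icc 0 t))
    {Rz Res I₂ I₃ Bt B0 : ℝ}
    (hR : Rz = ((N : ℝ) + 1)⁻¹ *
        (∑ᶠ (s : ℝ) (_ : s ∈ collisionTimes (Torus.geometry (Fin 3)) ε (fun r => Φ.flow r z) ∩ Ioc 0 t),
          ∑ i : Fin (N + 1), ∑ j : Fin (N + 1),
            (if i ≠ j ∧ ‖(Torus.geometry (Fin 3)).sepVec (Φ.flow s z i).1 (Φ.flow s z j).1‖ = ε then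
              φ s (Φ.flow s z i).1 (Φ.flow s z i).2 -
                φ s (Φ.flow s z i).1
                  (reflectVel ((Torus.geometry (Fin 3)).sepVec (Φ.flow s z i).1 (Φ.flow s z j).1)
                    ((Φ.flow s z i).2, (Φ.flow s z j).2)).1
            else 0)) -
        (∫ s in Icc 0 t, ∫ y, L s y.1 y.2 ∂(empiricalMeasure (Φ.flow s z))) + (1 / 2 : ℝ) * I₂)
    (hRes : Res = Bt - B0 - I₃) :
    |((N : ℝ) + 1)⁻¹ * (∑ i, φ t (Φ.flow t z i).1 (Φ.flow t z i).2) - Bt| ≤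
      |((N : ℝ) + 1)⁻¹ * (∑ i, φ 0 (z i).1 (z i).2) - B0| +
        η * t * (1 + ((N + 1 : ℕ) : ℝ)⁻¹ * ∑ i, ‖(z i).2‖ ^ 2) +
        |I₃ + (1 / 2 : ℝ) * I₂| + |Rz| + |Res| := by
  set S : ℝ := ∑ j, ‖(z j).2‖ ^ 2 with hS
  have hη : 0 ≤ η := by
    have h := (abs_nonneg _).trans (hDL 0 ⟨le_rfl, ht.le⟩ 0 0 (by rw [norm_zero, zero_pow two_ne_zero]; positivity))
    simpa using h
  obtain ⟨L', hL'L, hDL'⟩ := exists_cutKernel t S φ L hη hDL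
  have heq : ∀ s, (∫ y, L' s y.1 y.2 ∂(empiricalMeasure (Φ.flow s z))) =
      ∫ y, L s y.1 y.2 ∂(empiricalMeasure (Φ.flow s z)) :=
    orbit_integral_cutKernel_eq Φ hz L L' hL'L
  have hfun : (fun s => ∫ y, L' s y.1 y.2 ∂(empiricalMeasure (Φ.flow s z))) =
      fun s => ∫ y, L s y.1 y.2 ∂(empiricalMeasure (Φ.flow s z)) := funext heq
  have hLint' : IntegrableOn
      (fun s => ∫ y, L' s y.1 y.2 ∂(empiricalMeasure (Φ.flow s z))) (Icc 0 t) := by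
    rw [hfun]; exact hLint
  have hR' : Rz = ((N : ℝ) + 1)⁻¹ *
        (∑ᶠ (s : ℝ) (_ : s ∈ collisionTimes (Torus.geometry (Fin 3)) ε (fun r => Φ.flow r z) ∩ Ioc 0 t),
          ∑ i : Fin (N + 1), ∑ j : Fin (N + 1),
            (if i ≠ j ∧ ‖(Torus.geometry (Fin 3)).sepVec (Φ.flow s z i).1 (Φ.flow s z j).1‖ = ε then
              φ s (Φ.flow s z i).1 (Φ.flow s z i).2 -
                φ s (Φ.flow s z i).1
                  (reflectVel ((Torus.geometry (Fin 3)).sepVec (Φ.flow s z i).1 (Φ.flow s z j).1)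
                    ((Φ.flow s z i).2, (Φ.flow s z j).2)).1
            else 0)) -
        (∫ s in Icc 0 t, ∫ y, L' s y.1 y.2 ∂(empiricalMeasure (Φ.flow s z))) +
        (1 / 2 : ℝ) * I₂ := by
    rw [hfun]; exact hR
  exact pathwise_duality_bound Φ hz ht φ (L') hφ hDL'
    hLint' hR' hRes

/-- **The pathwise duality identity solved for the collision residual, velocity cutoff at the
energy shell.** As `pathwise_residual_bound`, but the defect bound `|Dφ + Lφ| ≤ η(1+|v|²)` on
`[0, t]` is asked only for `‖v‖² ≤ Σⱼ ‖vⱼ(0)‖²`. Conclusion unchanged: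
`|R| ≤ |A_t − B_t| + |A_0 − B_0| + η t (1 + e(z)) + |I₃ + ½I₂| + |Res|`.
[cite: PulvirentiSimonella2016, §2] -/
theorem pathwise_residual_bound_cut (Φ : HardSphereFlow (Torus.geometry (Fin 3)) ε (N + 1))
    {z : Config (N + 1) (Fin 3) T3} (hz : z ∈ Φ.good) {t : ℝ} (ht : 0 < t)
    (φ L : ℝ → T3 → V3 → ℝ) {η : ℝ}
    (hφ : ∀ x v, ContDiffOn ℝ 1
      (fun r => φ r ((Torus.geometry (Fin 3)).translate x (r • v)) v) (Icc 0 t))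
    (hDL : ∀ s ∈ Icc 0 t, ∀ x v, ‖v‖ ^ 2 ≤ ∑ j, ‖(z j).2‖ ^ 2 →
      |derivWithin (fun r => φ r ((Torus.geometry (Fin 3)).translate x ((r - s) • v)) v) (Icc 0 t) s +
        L s x v| ≤ η * (1 + ‖v‖ ^ 2))
    (hLint : IntegrableOn (fun s => ∫ y, L s y.1 y.2 ∂(empiricalMeasure (Φ.flow s z))) (Icc 0 t))
    {Rz Res I₂ I₃ Bt B0 : ℝ}
    (hR : Rz = ((N : ℝ) + 1)⁻¹ *
        (∑ᶠ (s : ℝ) (_ : s ∈ collisionTimes (Torus.geometry (Fin 3)) ε (fun r => Φ.flow r z) ∩ Ioc 0 t),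
          ∑ i : Fin (N + 1), ∑ j : Fin (N + 1),
            (if i ≠ j ∧ ‖(Torus.geometry (Fin 3)).sepVec (Φ.flow s z i).1 (Φ.flow s z j).1‖ = ε then
              φ s (Φ.flow s z i).1 (Φ.flow s z i).2 -
                φ s (Φ.flow s z i).1
                  (reflectVel ((Torus.geometry (Fin 3)).sepVec (Φ.flow s z i).1 (Φ.flow s z j).1)
                    ((Φ.flow s z i).2, (Φ.flow s z j).2)).1
            else 0)) -
        (∫ s in Icc 0 t, ∫ y, L s y.1 y.2 ∂(empiricalMeasure (Φ.flow s z))) + (1 / 2 : ℝ) * I₂)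
    (hRes : Res = Bt - B0 - I₃) :
    |Rz| ≤ |((N : ℝ) + 1)⁻¹ * (∑ i, φ t (Φ.flow t z i).1 (Φ.flow t z i).2) - Bt| +
      |((N : ℝ) + 1)⁻¹ * (∑ i, φ 0 (z i).1 (z i).2) - B0| +
        η * t * (1 + ((N + 1 : ℕ) : ℝ)⁻¹ * ∑ i, ‖(z i).2‖ ^ 2) +
        |I₃ + (1 / 2 : ℝ) * I₂| + |Res| := by
  set S : ℝ := ∑ j, ‖(z j).2‖ ^ 2 with hS
  have hη : 0 ≤ η := by
    have h := (abs_nonneg _).trans (hDL 0 ⟨le_rfl, ht.le⟩ 0 0 (by rw [norm_zero, zero_pow two_ne_zero]; positivity))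
    simpa using h
  obtain ⟨L', hL'L, hDL'⟩ := exists_cutKernel t S φ L hη hDL
  have heq : ∀ s, (∫ y, L' s y.1 y.2 ∂(empiricalMeasure (Φ.flow s z))) =
      ∫ y, L s y.1 y.2 ∂(empiricalMeasure (Φ.flow s z)) :=
    orbit_integral_cutKernel_eq Φ hz L L' hL'L
  have hfun : (fun s => ∫ y, L' s y.1 y.2 ∂(empiricalMeasure (Φ.flow s z))) =
      fun s => ∫ y, L s y.1 y.2 ∂(empiricalMeasure (Φ.flow s z)) := funext heq
  have hLint' : IntegrableOn
      (fun s => ∫ y, L' s y.1 y.2 ∂(empiricalMeasure (Φ.flow s z))) (Icc 0 t) := by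
    rw [hfun]; exact hLint
  have hR' : Rz = ((N : ℝ) + 1)⁻¹ *
        (∑ᶠ (s : ℝ) (_ : s ∈ collisionTimes (Torus.geometry (Fin 3)) ε (fun r => Φ.flow r z) ∩ Ioc 0 t),
          ∑ i : Fin (N + 1), ∑ j : Fin (N + 1),
            (if i ≠ j ∧ ‖(Torus.geometry (Fin 3)).sepVec (Φ.flow s z i).1 (Φ.flow s z j).1‖ = ε then
              φ s (Φ.flow s z i).1 (Φ.flow s z i).2 -
                φ s (Φ.flow s z i).1
                  (reflectVel ((Torus.geometry (Fin 3)).sepVec (Φ.flow s z i).1 (Φ.flow s z j).1)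
                    ((Φ.flow s z i).2, (Φ.flow s z j).2)).1
            else 0)) -
        (∫ s in Icc 0 t, ∫ y, L' s y.1 y.2 ∂(empiricalMeasure (Φ.flow s z))) +
        (1 / 2 : ℝ) * I₂ := by
    rw [hfun]; exact hR
  exact pathwise_residual_bound Φ hz ht φ (L') hφ hDL'
    hLint' hR' hRes

/-- **Polynomial version (no smallness): the residual under a GLOBAL polynomial defect bound.**
If `|Dφ + Lφ| ≤ C_g (1+|v|²)³` for all `v` on `[0, t]`, then along a good orbit
`|R| ≤ |A_t − B_t| + |A_0 − B_0| + C_g (1 + Σⱼ|vⱼ(0)|²)² t (1 + e(z)) + |I₃ + ½I₂| + |Res|`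
(below the energy shell `(1+|v|²)³ ≤ (1 + Σⱼ|vⱼ|²)²(1+|v|²)`, then `pathwise_residual_bound_cut`).
This is the crude bound used on the large-energy event of the velocity-cutoff assembly.
[cite: PulvirentiSimonella2016, §2] -/
theorem pathwise_residual_bound_poly (Φ : HardSphereFlow (Torus.geometry (Fin 3)) ε (N + 1))
    {z : Config (N + 1) (Fin 3) T3} (hz : z ∈ Φ.good) {t : ℝ} (ht : 0 < t)
    (φ L : ℝ → T3 → V3 → ℝ) {Cg : ℝ}
    (hφ : ∀ x v, ContDiffOn ℝ 1
      (fun r => φ r ((Torus.geometry (Fin 3)).translate x (r • v)) v) (Icc 0 t))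
    (hDLg : ∀ s ∈ Icc 0 t, ∀ x v,
      |derivWithin (fun r => φ r ((Torus.geometry (Fin 3)).translate x ((r - s) • v)) v) (Icc 0 t) s +
        L s x v| ≤ Cg * (1 + ‖v‖ ^ 2) ^ 3)
    (hLint : IntegrableOn (fun s => ∫ y, L s y.1 y.2 ∂(empiricalMeasure (Φ.flow s z))) (Icc 0 t))
    {Rz Res I₂ I₃ Bt B0 : ℝ}
    (hR : Rz = ((N : ℝ) + 1)⁻¹ *
        (∑ᶠ (s : ℝ) (_ : s ∈ collisionTimes (Torus.geometry (Fin 3)) ε (fun r => Φ.flow r z) ∩ Ioc 0 t),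
          ∑ i : Fin (N + 1), ∑ j : Fin (N + 1),
            (if i ≠ j ∧ ‖(Torus.geometry (Fin 3)).sepVec (Φ.flow s z i).1 (Φ.flow s z j).1‖ = ε then
              φ s (Φ.flow s z i).1 (Φ.flow s z i).2 -
                φ s (Φ.flow s z i).1
                  (reflectVel ((Torus.geometry (Fin 3)).sepVec (Φ.flow s z i).1 (Φ.flow s z j).1)
                    ((Φ.flow s z i).2, (Φ.flow s z j).2)).1
            else 0)) -
        (∫ s in Icc 0 t, ∫ y, L s y.1 y.2 ∂(empiricalMeasure (Φ.flow s z))) + (1 / 2 : ℝ) * I₂)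
    (hRes : Res = Bt - B0 - I₃) :
    |Rz| ≤ |((N : ℝ) + 1)⁻¹ * (∑ i, φ t (Φ.flow t z i).1 (Φ.flow t z i).2) - Bt| +
      |((N : ℝ) + 1)⁻¹ * (∑ i, φ 0 (z i).1 (z i).2) - B0| +
        Cg * (1 + ∑ j, ‖(z j).2‖ ^ 2) ^ 2 * t * (1 + ((N + 1 : ℕ) : ℝ)⁻¹ * ∑ i, ‖(z i).2‖ ^ 2) +
        |I₃ + (1 / 2 : ℝ) * I₂| + |Res| := by
  set S : ℝ := ∑ j, ‖(z j).2‖ ^ 2 with hS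
  have hS0 : 0 ≤ S := by positivity
  have hCg : 0 ≤ Cg := by
    have h := (abs_nonneg _).trans (hDLg 0 ⟨le_rfl, ht.le⟩ 0 0)
    have h1 : (0 : ℝ) ≤ Cg * 1 := by simpa using h
    linarith
  have hDL : ∀ s ∈ Icc 0 t, ∀ x v, ‖v‖ ^ 2 ≤ S →
      |derivWithin (fun r => φ r ((Torus.geometry (Fin 3)).translate x ((r - s) • v)) v) (Icc 0 t) s +
        L s x v| ≤ Cg * (1 + S) ^ 2 * (1 + ‖v‖ ^ 2) := by
    intro s hs x v hv
    refine (hDLg s hs x v).trans ?_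
    have h1 : (1 + ‖v‖ ^ 2) ^ 3 = (1 + ‖v‖ ^ 2) ^ 2 * (1 + ‖v‖ ^ 2) := by ring
    have h2 : (1 + ‖v‖ ^ 2) ^ 2 ≤ (1 + S) ^ 2 :=
      pow_le_pow_left₀ (by positivity) (by linarith) 2
    rw [h1, mul_assoc]
    exact mul_le_mul_of_nonneg_left (mul_le_mul_of_nonneg_right h2 (by positivity)) hCg
  exact pathwise_residual_bound_cut Φ hz ht φ L hφ hDL hLint hR hRes

/-- **Registered form** (sub-goal `cutoff_pathwise_residual_bound` of the crux stmt-AtomisticToContinuum-14658, line `birth`): `pathwise_residual_bound_cut` as a closed `∀`-statement — the pathwise duality identity solved for the collision residual, with the defect bound asked only below the energy shell of the datum. [cite: PulvirentiSimonella2016, §2] -/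
theorem cutoff_pathwise_residual_bound : ∀ {N : ℕ} {ε : ℝ} (Φ : HardSphereFlow (Torus.geometry (Fin 3)) ε (N + 1)) {z : Config (N + 1) (Fin 3) T3} (hz : z ∈ Φ.good) {t : ℝ} (ht : 0 < t) (φ L : ℝ → T3 → V3 → ℝ) {η : ℝ} (hφ : ∀ x v, ContDiffOn ℝ 1 (fun r => φ r ((Torus.geometry (Fin 3)).translate x (r • v)) v) (Icc 0 t)) (hDL : ∀ s ∈ Icc 0 t, ∀ x v, ‖v‖ ^ 2 ≤ ∑ j, ‖(z j).2‖ ^ 2 → |derivWithin (fun r => φ r ((Torus.geometry (Fin 3)).translate x ((r - s) • v)) v) (Icc 0 t) s + L s x v| ≤ η * (1 + ‖v‖ ^ 2)) (hLint : IntegrableOn (fun s => ∫ y, L s y.1 y.2 ∂(empiricalMeasure (Φ.flow s z))) (Icc 0 t)) {Rz Res I₂ I₃ Bt B0 : ℝ} (hR : Rz = ((N : ℝ) + 1)⁻¹ * (∑ᶠ (s : ℝ) (_ : s ∈ collisionTimes (Torus.geometry (Fin 3)) ε (fun r => Φ.flow r z) ∩ Ioc 0 t), ∑ i : Fin (N +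 1), ∑ j : Fin (N + 1), (if i ≠ j ∧ ‖(Torus.geometry (Fin 3)).sepVec (Φ.flow s z i).1 (Φ.flow s z j).1‖ = ε then φ s (Φ.flow s z i).1 (Φ.flow s z i).2 - φ s (Φ.flow s z i).1 (reflectVel ((Torus.geometry (Fin 3)).sepVec (Φ.flow s z i).1 (Φ.flow s z j).1) ((Φ.flow s z i).2, (Φ.flow s z j).2)).1 else 0)) - (∫ s in Icc 0 t, ∫ y, L s y.1 y.2 ∂(empiricalMeasure (Φ.flow s z))) + (1 / 2 : ℝ) * I₂) (hRes : Res = Bt - B0 - I₃), |Rz| ≤ |((N : ℝ) + 1)⁻¹ * (∑ i, φ t (Φ.flow t z i).1 (Φ.flow t z i).2) - Bt| + |((N : ℝ) + 1)⁻¹ * (∑ i, φ 0 (z i).1 (z i).2) - B0| + η * t * (1 + ((N + 1 : ℕ) : ℝ)⁻¹ * ∑ i, ‖(z i).2‖ ^ 2) + |I₃ + (1 / 2 : ℝ) * I₂| + |Res| :=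
  @pathwise_residual_bound_cut

end Summit.AtomisticToContinuum.HydrodynamicLimit.Theorems

end
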